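import Literature.NumberTheory.Sieve.TwistedWeightMellinInversion
import Literature.NumberTheory.Sieve.SmoothZetaComplex
import HarnessLib

/-!
# The Mellin representation of twisted weighted sums over smooth numbers

Topic `Literature/NumberTheory/Sieve`; a PROVED tool file toward
`Literature.NumberTheory.DiophantineGeometry.XYZUpperHalf` ([Harper2016, Cor. 1], smoothed major
arcs). With `W_λ(v) = v²(1−v)²e(λv)` (`twistWeight`), `Ŵ_λ = twistMellin λ` and
`ζ(s, y) = ∑_{n ∈ S(y)} n^{−s}` (`smoothZetaC`), Mellin inversion and absolute convergence give

`sum_twistWeight_eq_integral`: for `x > 0`, `σ > 0`,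
`∑_{n ≤ x, n ∈ S(y)} W_λ(n/x) = (2π)⁻¹ ∫_ℝ x^{σ+it} Ŵ_λ(σ+it) ζ(σ+it, y) dt`,

the starting point of the saddle-point evaluation of the exponential sum
`∑_{n ∈ S(y)} w(n/x) e(λn/x)` on the major arc `θ = λ/x`.

## References

* A. J. Harper, Compositio Math. 152 (2016), §5 [Harper2016].
* A. Hildebrand, G. Tenenbaum, Trans. AMS 296 (1986), §3 (Perron/Mellin for `ζ(s,y)`) [HildebrandTenenbaum1986].
-/

noncomputable section

open Real Complex MeasureTheory Set Filter
open scoped FourierTransform Topology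

namespace Literature.NumberTheory.Sieve

namespace TwistedWeight

/-- `(a/b)^{−s} = b^{s} a^{−s}` for positive reals `a, b`. [folklore] -/
theorem ofReal_div_cpow_neg {a b : ℝ} (ha : 0 < a) (hb : 0 < b) (s : ℂ) :
    (((a / b : ℝ)) : ℂ) ^ (-s) = (b : ℂ) ^ s * (a : ℂ) ^ (-s) := by
  have hab : 0 < a / b := div_pos ha hb
  have h1 : (((a / b : ℝ)) : ℂ) ≠ 0 := by exact_mod_cast hab.ne'
  have h2 : (a : ℂ) ≠ 0 := by exact_mod_cast ha.ne'
  have h3 : (b : ℂ) ≠ 0 := by exact_mod_cast hb.ne'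
  rw [Complex.cpow_def_of_ne_zero h1, Complex.cpow_def_of_ne_zero h2, Complex.cpow_def_of_ne_zero h3,
    ← Complex.exp_add]
  congr 1
  rw [show (((a / b : ℝ)) : ℂ) = ((a / b : ℝ) : ℂ) from rfl, ← Complex.ofReal_log hab.le,
    ← Complex.ofReal_log ha.le, ← Complex.ofReal_log hb.le, Real.log_div ha.ne' hb.ne']
  push_cast; ring

/-- `‖v^{−(σ+it)}‖ = v^{−σ}` for `v > 0` (cf. `Literature.Analysis.Complex.norm_cpow_neg_add_mul_I`,
not imported here to keep the import closure small). [folklore] -/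
private theorem norm_ofReal_cpow_neg {v : ℝ} (hv : 0 < v) (σ t : ℝ) :
    ‖(v : ℂ) ^ (-((σ : ℂ) + t * I))‖ = v ^ (-σ) := by
  rw [Complex.norm_cpow_eq_rpow_re_of_pos hv]; simp

/-- The integrands `F_n(t) = (2π)⁻¹ 1_{S(y)}(n) (n/x)^{−(σ+it)} Ŵ_λ(σ+it)`. [folklore] -/
def mellinTerm (x σ : ℝ) (y : ℕ) (lam : ℝ) (n : ℕ) (t : ℝ) : ℂ :=
  (1 / (2 * π) : ℝ) • ((Nat.smoothNumbers (y + 1)).indicator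
    (fun m : ℕ => (((m / x : ℝ)) : ℂ) ^ (-((σ : ℂ) + t * I))) n * twistMellin lam (σ + t * I))

/-- `∫ F_n = 1_{S(y)}(n) W_λ(n/x)` (Mellin inversion). [folklore] -/
theorem integral_mellinTerm {x σ : ℝ} (hx : 0 < x) (hσ : 0 < σ) (y : ℕ) (lam : ℝ) (n : ℕ) :
    ∫ t : ℝ, mellinTerm x σ y lam n t =
      (Nat.smoothNumbers (y + 1)).indicator (fun m : ℕ => twistWeight lam (m / x)) n := by
  unfold mellinTerm
  by_cases hn : n ∈ Nat.smoothNumbers (y + 1)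
  · simp only [Set.indicator_of_mem hn]
    have hn0 : 0 < n := Nat.pos_of_ne_zero (Nat.ne_zero_of_mem_smoothNumbers hn)
    have hv : 0 < (n : ℝ) / x := div_pos (by exact_mod_cast hn0) hx
    rw [integral_smul, twistWeight_eq_mellinInv hσ lam hv]
    simp only [smul_eq_mul]
  · simp only [Set.indicator_of_notMem hn, zero_mul, smul_zero, integral_zero]

/-- Each `F_n` is integrable. [folklore] -/
theorem integrable_mellinTerm {x σ : ℝ} (hx : 0 < x) (hσ : 0 < σ) (y : ℕ) (lam : ℝ) (n : ℕ) :
    Integrable (mellinTerm x σ y lam n) := by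
  unfold mellinTerm
  by_cases hn : n ∈ Nat.smoothNumbers (y + 1)
  · simp only [Set.indicator_of_mem hn]
    have hn0 : 0 < n := Nat.pos_of_ne_zero (Nat.ne_zero_of_mem_smoothNumbers hn)
    have hv : 0 < (n : ℝ) / x := div_pos (by exact_mod_cast hn0) hx
    have hf : Integrable fun t : ℝ => (((((n : ℝ) / x : ℝ)) : ℂ)) ^ (-((σ : ℂ) + t * I)) *
        twistMellin lam (σ + t * I) := by
      refine (integrable_twistMellin_vertical hσ lam).bdd_mul (c := ((n : ℝ) / x) ^ (-σ)) ?_ ?_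
      · -- continuity of `t ↦ (n/x)^{-(σ+it)}`
        have hc : Continuous fun t : ℝ => (((((n : ℝ) / x : ℝ)) : ℂ)) ^ (-((σ : ℂ) + t * I)) := by
          have hne : ((((n : ℝ) / x : ℝ)) : ℂ) ≠ 0 := by exact_mod_cast hv.ne'
          have : (fun t : ℝ => (((((n : ℝ) / x : ℝ)) : ℂ)) ^ (-((σ : ℂ) + t * I))) =
              fun t : ℝ => Complex.exp (Complex.log ((((n : ℝ) / x : ℝ)) : ℂ) * (-((σ : ℂ) + t * I))) := by
            funext t; rw [Complex.cpow_def_of_ne_zero hne]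
          rw [this]; fun_prop
        exact hc.aestronglyMeasurable
      · exact Eventually.of_forall fun t => (norm_ofReal_cpow_neg hv σ t).le
    exact hf.smul ((1 / (2 * π) : ℝ))
  · simp only [Set.indicator_of_notMem hn, zero_mul, smul_zero]
    exact integrable_zero _ _ _

/-- `∫ ‖F_n‖ = (2π)⁻¹ 1_{S(y)}(n) (n/x)^{−σ} ∫ ‖Ŵ_λ(σ+it)‖ dt`. [folklore] -/
theorem integral_norm_mellinTerm {x σ : ℝ} (hx : 0 < x) (y : ℕ) (lam : ℝ) (n : ℕ) :
    ∫ t : ℝ, ‖mellinTerm x σ y lam n t‖ =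
      (1 / (2 * π)) * ((Nat.smoothNumbers (y + 1)).indicator (fun m : ℕ => ((m : ℝ) / x) ^ (-σ)) n *
        ∫ t : ℝ, ‖twistMellin lam (σ + t * I)‖) := by
  unfold mellinTerm
  by_cases hn : n ∈ Nat.smoothNumbers (y + 1)
  · simp only [Set.indicator_of_mem hn]
    have hn0 : 0 < n := Nat.pos_of_ne_zero (Nat.ne_zero_of_mem_smoothNumbers hn)
    have hv : 0 < (n : ℝ) / x := div_pos (by exact_mod_cast hn0) hx
    rw [← integral_const_mul, ← integral_const_mul]
    refine integral_congr_ae (Eventually.of_forall fun t => ?_)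
    simp only
    rw [norm_smul, norm_mul, norm_ofReal_cpow_neg hv, Real.norm_eq_abs, abs_of_pos (by positivity)]
  · simp only [Set.indicator_of_notMem hn, zero_mul, smul_zero, norm_zero, integral_zero, mul_zero]

/-- `n ↦ ∫ ‖F_n‖` is summable (from `∑_{n ∈ S(y)} n^{−σ} = ζ(σ, y) < ∞`). [folklore] -/
theorem summable_integral_norm_mellinTerm {x σ : ℝ} (hx : 0 < x) (hσ : 0 < σ) (y : ℕ) (lam : ℝ) :
    Summable fun n : ℕ => ∫ t : ℝ, ‖mellinTerm x σ y lam n t‖ := by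
  have hsum : Summable fun n : ℕ => ‖LSeries.term (smoothIndicator y) (σ : ℂ) n‖ :=
    (LSeriesSummable_smoothIndicator (s := (σ : ℂ)) (by simp; exact hσ) y).norm
  have heq : ∀ n : ℕ, ∫ t : ℝ, ‖mellinTerm x σ y lam n t‖ =
      ((1 / (2 * π)) * x ^ σ * ∫ t : ℝ, ‖twistMellin lam (σ + t * I)‖) *
        ‖LSeries.term (smoothIndicator y) (σ : ℂ) n‖ := by
    intro n
    rw [integral_norm_mellinTerm hx y lam n, term_smoothIndicator]
    by_cases hn : n ∈ Nat.smoothNumbers (y + 1)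
    · rw [Set.indicator_of_mem hn, Set.indicator_of_mem hn]
      have hn0 : 0 < n := Nat.pos_of_ne_zero (Nat.ne_zero_of_mem_smoothNumbers hn)
      have hnr : (0 : ℝ) < n := by exact_mod_cast hn0
      rw [Complex.norm_natCast_cpow_of_pos hn0]
      simp only [Complex.neg_re, Complex.ofReal_re]
      have hxσ : x ^ σ ≠ 0 := (Real.rpow_pos_of_pos hx σ).ne'
      have hdiv : ((n : ℝ) / x) ^ (-σ) = x ^ σ * (n : ℝ) ^ (-σ) := by
        rw [Real.div_rpow hnr.le hx.le, Real.rpow_neg hx.le, div_inv_eq_mul, mul_comm]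
      rw [hdiv]; ring
    · rw [Set.indicator_of_notMem hn, Set.indicator_of_notMem hn, norm_zero]; ring
  simp_rw [heq]
  exact hsum.mul_left _

/-- The sum over smooth `n ≤ x` of `W_λ(n/x)`, as a `HasSum` of the indicator. [folklore] -/
theorem hasSum_twistWeight {x : ℝ} (hx : 0 < x) (y : ℕ) (lam : ℝ) :
    HasSum (fun n : ℕ => (Nat.smoothNumbers (y + 1)).indicator (fun m : ℕ => twistWeight lam (m / x)) n)
      (∑ n ∈ Nat.smoothNumbersUpTo ⌊x⌋₊ (y + 1), twistWeight lam (n / x)) := by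
  have h1 : ∑ n ∈ Nat.smoothNumbersUpTo ⌊x⌋₊ (y + 1), twistWeight lam (n / x) =
      ∑ n ∈ Nat.smoothNumbersUpTo ⌊x⌋₊ (y + 1),
        (Nat.smoothNumbers (y + 1)).indicator (fun m : ℕ => twistWeight lam (m / x)) n := by
    refine Finset.sum_congr rfl fun n hn => ?_
    rw [Nat.mem_smoothNumbersUpTo] at hn
    rw [Set.indicator_of_mem hn.2]
  rw [h1]
  refine hasSum_sum_of_ne_finset_zero fun n hn => ?_
  by_cases hS : n ∈ Nat.smoothNumbers (y + 1)
  · rw [Set.indicator_of_mem hS]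
    -- `n > ⌊x⌋`, so `n/x > 1` and `W = 0`
    have hnx : ¬ n ≤ ⌊x⌋₊ := fun h => hn (Nat.mem_smoothNumbersUpTo.mpr ⟨h, hS⟩)
    apply twistWeight_of_not_mem
    intro hmem
    have h2 : (n : ℝ) / x ≤ 1 := hmem.2
    rw [div_le_one hx] at h2
    exact hnx (Nat.le_floor h2)
  · rw [Set.indicator_of_notMem hS]

/-- The pointwise sum `∑_n F_n(t) = (2π)⁻¹ x^{σ+it} Ŵ_λ(σ+it) ζ(σ+it, y)`. [folklore] -/
theorem tsum_mellinTerm {x σ : ℝ} (hx : 0 < x) (hσ : 0 < σ) (y : ℕ) (lam : ℝ) (t : ℝ) :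
    ∑' n : ℕ, mellinTerm x σ y lam n t =
      (1 / (2 * π) : ℝ) • ((x : ℂ) ^ ((σ : ℂ) + t * I) * twistMellin lam (σ + t * I) *
        smoothZetaC ((σ : ℂ) + t * I) y) := by
  unfold mellinTerm
  rw [tsum_const_smul'' ]
  congr 1
  have hs : 0 < ((σ : ℂ) + t * I).re := by simp; exact hσ
  have hL := (LSeriesHasSum_smoothIndicator hs y).tsum_eq
  -- rewrite each indicator term
  have hterm : ∀ n : ℕ, (Nat.smoothNumbers (y + 1)).indicator
      (fun m : ℕ => (((m / x : ℝ)) : ℂ) ^ (-((σ : ℂ) + t * I))) n * twistMellin lam (σ + t * I) =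
      ((x : ℂ) ^ ((σ : ℂ) + t * I) * twistMellin lam (σ + t * I)) * LSeries.term (smoothIndicator y) ((σ : ℂ) + t * I) n := by
    intro n
    rw [term_smoothIndicator]
    by_cases hn : n ∈ Nat.smoothNumbers (y + 1)
    · rw [Set.indicator_of_mem hn, Set.indicator_of_mem hn]
      have hn0 : 0 < n := Nat.pos_of_ne_zero (Nat.ne_zero_of_mem_smoothNumbers hn)
      rw [ofReal_div_cpow_neg (by exact_mod_cast hn0) hx]; push_cast; ring
    · rw [Set.indicator_of_notMem hn, Set.indicator_of_notMem hn]; ring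
  simp_rw [hterm]
  rw [tsum_mul_left]
  rw [hL]

/-- **The Mellin representation** of the twisted weighted sum over smooth numbers. See the module
docstring. [cite: HildebrandTenenbaum1986, §3] [cite: Harper2016, §5] -/
theorem sum_twistWeight_eq_integral {x σ : ℝ} (hx : 0 < x) (hσ : 0 < σ) (y : ℕ) (lam : ℝ) :
    ∑ n ∈ Nat.smoothNumbersUpTo ⌊x⌋₊ (y + 1), twistWeight lam (n / x) =
      (1 / (2 * π) : ℝ) • ∫ t : ℝ, (x : ℂ) ^ ((σ : ℂ) + t * I) * twistMellin lam (σ + t * I) *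
        smoothZetaC ((σ : ℂ) + t * I) y := by
  have hC := hasSum_integral_of_summable_integral_norm (integrable_mellinTerm hx hσ y lam)
    (summable_integral_norm_mellinTerm hx hσ y lam)
  simp_rw [integral_mellinTerm hx hσ y lam] at hC
  have hB := hasSum_twistWeight hx y lam
  rw [hB.unique hC]
  simp_rw [tsum_mellinTerm hx hσ y lam]
  rw [integral_smul]

end TwistedWeight

end Literature.NumberTheory.Sieve

end
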